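import Summits.CriticalPhenomena.PercolationContinuityZ3.Theorems.PercNearOneGluingNoHeavyLowerTailCILStarTransfer
import HarnessLib

/-!
# `NoHeavyLowerTail` (stmt-CriticalPhenomena-4575) — the T-form (attached champion, XZ) from GUARDED star stability;
# gate domination with STEINER gates

Support file (prover `prim-hp-5`, hull-port cell, technique "blob-quotient induction" / T-form calculus, gen 3;
`--supports stmt-CriticalPhenomena-4575`).  No definitions, no named facts, no sorries.

Notation: `μ = prodBernoulli w` on `Fin n`, relays `A`, observer `o ∉ A`, level `j`, `π(v) = {x ∈ A : v ↔ x}`,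
`N = |π(o)|`, `L = {1 ≤ N ≤ j}`; `x ~' y` an open path using no edge at `o` (the graph `K = G − o`), `π'(v)`,
`π'(B) = ⋃_{y ∈ B} π'(y)`, `s(y) = μ{|π'(y)| ≤ j}` the `K`-lightness of ANY vertex `y` (relay or not).
The T-form (the conclusion of the registered stubs `stub_attachedChampion` / `stub_attachedChampionDeleted`, "XZ") at
`o` with witness `q` is `μ(L) ≤ μ({|π(q)| ≤ j} ∩ {1 ≤ N})`; it implies CIL with the same witness and — unlike CIL — it
composes through cut observers and Steiner ports (`CutObserver.SteinerPorts.tform_port`, `….Blocks.tform_blocks`).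

The star transfer of `…CILStarTransfer` (decompose by the star `σ_B` of `o`; on `σ_B`, `π(o) = π'(B)`) is run here
WITH THE GUARD `{1 ≤ N}` kept on the right: on `σ_B` the guard reads `1 ≤ |π'(B)|`, so the per-star input becomes the
GUARDED set stability `μ(q ≁' B, 1 ≤ |π'(B)| ≤ j) ≤ μ(q ≁' B, 1 ≤ |π'(B)| ∧ |π'(q)| ≤ j)` (the T-form at the glued
set `B` in `K`, restricted to `{q ≁' B}` — the "TCS" shape of the ttrl census `run/shared/lean/ttrl/tcs/`).

* `CutObserver.star_transfer_guarded` — one star: guarded stability for `B` in `K` ⇒ `μ(L ∩ σ_B) ≤ μ(R_q ∩ {1 ≤ N} ∩ σ_B)`.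
* `CutObserver.guardedStability_of_member` — **the guarded stability inequality for `B` holds whenever SOME member
  `y ∈ B` — relay OR STEINER — is no lighter than `q` (`s(y) ≤ s(q)`)**: `|π'(y)| ≤ |π'(B)|` pointwise, the mass
  `{|π'(B)| = 0}` (where `|π'(y)| = 0 ≤ j`) is removed from both sides, and in between sits separation stability
  `CutObserver.separation_stable` (BHK 2006 Thm 1.5) for the pair `(q, y)` away from `B`.
* `tform_of_guardedStarStability` — **T-form at `o` with witness `q` from guarded stability of the stars made entirely
  of vertices lighter than `q`** (the guarded twin of `Theorems.cil_of_starStability`).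
* `attachedChampion_of_gates_dominated` — **corollary: if EVERY positive-weight neighbour `y` of `o` (relay or Steiner)
  satisfies `s(y) ≤ s(q)`, then `μ{1 ≤ N ≤ j} ≤ μ({|π(q)| ≤ j} ∩ {1 ≤ N})`.**  This extends
  `Theorems.attachedChampion_of_relayPorts_dominated` (all neighbours relays) to Steiner gates; the CIL-form with Steiner
  gates was `Theorems.cumulativeIsolation_of_heavySteinerNeighbours` / `cil_of_starStability`, whose right-hand side
  `μ{|π(q)| ≤ j}` (or the guard "some edge at `o` is open" of `Theorems.xz_add_starDeficiency`) does not compose.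
  So "observer whose gates are all `K`-dominated by `q`" is a new ATOM of the T-form calculus (series–parallel closure,
  memo TFORM-TRANSFER.md §7 of this seat).

Numerics (this seat, exact partition law, `lab/gkd_test.py`): 0 violations in 8 030 dominated (instance, level, witness)
triples, `n ≤ 7`.
-/

noncomputable section

namespace Summit.CriticalPhenomena.PercolationContinuityZ3.Theorems

open MeasureTheory Set Literature.Probability.LatticeModels Literature.Probability.Percolation
open scoped Classical BigOperators

variable {n : ℕ}

namespace CutObserver

/-- **Guarded star transfer (one star).**  Let `o ∉ A`, `q ≠ o`, `B` a set of vertices `≠ o`, `σ_B` the star event,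
`L = {1 ≤ N ≤ j}`, `R_q = {|π(q)| ≤ j}`.  If `μ(q ≁' B, 1 ≤ |π'(B)| ≤ j) ≤ μ(q ≁' B, 1 ≤ |π'(B)| ∧ |π'(q)| ≤ j)`
(events of the configuration off `o`), then `μ(L ∩ σ_B) ≤ μ(R_q ∩ {1 ≤ N} ∩ σ_B)`.  (Proof of
`CutObserver.star_transfer` with the guard carried: on `σ_B`, `1 ≤ |π'(B)|` is `1 ≤ N`.) [folklore] -/
theorem star_transfer_guarded (w : Sym2 (Fin n) → unitInterval) (A : Finset (Fin n)) (o q : Fin n) (j : ℕ)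
    (hoA : o ∉ A) (hqo : q ≠ o) (B : Finset (Fin n)) (hBo : ∀ y ∈ B, y ≠ o)
    (hCS : (prodBernoulli w).real {ω : BondConfig (Fin n) |
        (∀ y ∈ B, ¬ (openGraph (ω ∩ {e | o ∉ e})).Reachable q y) ∧
          1 ≤ (A.filter fun z => ∃ y ∈ B, (openGraph (ω ∩ {e | o ∉ e})).Reachable y z).card ∧
          (A.filter fun z => ∃ y ∈ B, (openGraph (ω ∩ {e | o ∉ e})).Reachable y z).card ≤ j} ≤
      (prodBernoulli w).real {ω : BondConfig (Fin n) |
        (∀ y ∈ B, ¬ (openGraph (ω ∩ {e | o ∉ e})).Reachable q y) ∧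
          1 ≤ (A.filter fun z => ∃ y ∈ B, (openGraph (ω ∩ {e | o ∉ e})).Reachable y z).card ∧
          (A.filter fun z => (openGraph (ω ∩ {e | o ∉ e})).Reachable q z).card ≤ j}) :
    (prodBernoulli w).real ({ω : BondConfig (Fin n) |
        1 ≤ (A.filter fun x => ω ∈ openConn o x).card ∧ (A.filter fun x => ω ∈ openConn o x).card ≤ j} ∩
        starEvent o ↑B) ≤
      (prodBernoulli w).real ({ω : BondConfig (Fin n) | (A.filter fun x => ω ∈ openConn q x).card ≤ j ∧
          1 ≤ (A.filter fun x => ω ∈ openConn o x).card} ∩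
        starEvent o ↑B) := by
  haveI : IsProbabilityMeasure (prodBernoulli w) := inferInstance
  set μ := prodBernoulli w with hμ
  set R' : BondConfig (Fin n) → Fin n → Fin n → Prop := fun ω x y =>
    (openGraph (ω ∩ {e | o ∉ e})).Reachable x y with hR'
  set L := {ω : BondConfig (Fin n) |
    1 ≤ (A.filter fun x => ω ∈ openConn o x).card ∧ (A.filter fun x => ω ∈ openConn o x).card ≤ j} with hL
  set Rq := {ω : BondConfig (Fin n) | (A.filter fun x => ω ∈ openConn q x).card ≤ j ∧
    1 ≤ (A.filter fun x => ω ∈ openConn o x).card} with hRq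
  set σ := starEvent o (↑B : Set (Fin n)) with hσdef
  set V := {ω : BondConfig (Fin n) | (openGraph ω).Reachable q o} with hV
  -- the two `K`-events, written as events of `ω ∩ {e | o ∉ e}`
  set PL : BondConfig (Fin n) → Prop := fun ξ =>
    (∀ y ∈ B, ¬ (openGraph ξ).Reachable q y) ∧
      1 ≤ (A.filter fun z => ∃ y ∈ B, (openGraph ξ).Reachable y z).card ∧
      (A.filter fun z => ∃ y ∈ B, (openGraph ξ).Reachable y z).card ≤ j with hPL
  set PR : BondConfig (Fin n) → Prop := fun ξ =>
    (∀ y ∈ B, ¬ (openGraph ξ).Reachable q y) ∧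
      1 ≤ (A.filter fun z => ∃ y ∈ B, (openGraph ξ).Reachable y z).card ∧
      (A.filter fun z => (openGraph ξ).Reachable q z).card ≤ j with hPR
  set CSL := {ω : BondConfig (Fin n) | PL (ω ∩ {e | o ∉ e})} with hCSL
  set CSR := {ω : BondConfig (Fin n) | PR (ω ∩ {e | o ∉ e})} with hCSR
  have hkey : μ.real CSL ≤ μ.real CSR := hCS
  -- on σ: π(o) = π'(B)
  have hF3 : ∀ ω ∈ σ, (A.filter fun x => ω ∈ openConn o x) =
      (A.filter fun z => ∃ y ∈ B, R' ω y z) := by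
    intro ω hω
    refine Finset.filter_congr fun x hx => ⟨fun h => ?_, fun h => ?_⟩
    · have hxo : x ≠ o := fun h' => hoA (h' ▸ hx)
      obtain ⟨y, hy, hyx⟩ := exists_avoid_of_reachable_star hω hxo h
      exact ⟨y, Finset.mem_coe.1 hy, hyx⟩
    · obtain ⟨y, hy, hyx⟩ := h
      exact reachable_of_mem_star hω (hBo y hy) (Finset.mem_coe.2 hy) hyx
  -- off V: π(q) = π'(q) and q ≁' B
  have hF4a : ∀ ω, ω ∉ V → (A.filter fun x => ω ∈ openConn q x) = (A.filter fun z => R' ω q z) := by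
    intro ω hVω
    refine Finset.filter_congr fun x _ => ⟨fun h => ?_, fun h => reachable_mono inter_subset_left h⟩
    exact reachable_avoiding_of_not_reachable hVω h
  have hF4b : ∀ ω ∈ σ, ω ∉ V → ∀ y ∈ B, ¬ R' ω q y := by
    intro ω hω hVω y hy hqy
    exact hVω ((reachable_of_mem_star hω (hBo y hy) (Finset.mem_coe.2 hy) hqy.symm).symm)
  -- on σ: q ≁' B ⇒ q ≁ o
  have hF5 : ∀ ω ∈ σ, (∀ y ∈ B, ¬ R' ω q y) → ω ∉ V := by
    intro ω hω hny hVω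
    obtain ⟨y, hy, hyq⟩ := exists_avoid_of_reachable_star hω hqo (SimpleGraph.Reachable.symm hVω)
    exact hny y (Finset.mem_coe.1 hy) hyq.symm
  -- (a) L ∩ σ ∩ V ⊆ Rq ∩ σ ∩ V
  have ha : L ∩ σ ∩ V ⊆ Rq ∩ σ ∩ V := by
    rintro ω ⟨⟨hLω, hω⟩, hVω⟩
    refine ⟨⟨⟨?_, hLω.1⟩, hω⟩, hVω⟩
    have heq : (A.filter fun x => ω ∈ openConn q x) = (A.filter fun x => ω ∈ openConn o x) :=
      Finset.filter_congr fun x _ => ⟨fun h => (SimpleGraph.Reachable.symm hVω).trans h, fun h => hVω.trans h⟩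
    rw [heq]; exact hLω.2
  -- (b) (L ∩ σ) \ V ⊆ σ ∩ CSL
  have hb : (L ∩ σ) \ V ⊆ σ ∩ CSL := by
    rintro ω ⟨⟨hLω, hω⟩, hVω⟩
    refine ⟨hω, ?_⟩
    show PL (ω ∩ {e | o ∉ e})
    refine ⟨hF4b ω hω hVω, ?_, ?_⟩
    · have := hLω.1; rw [hF3 ω hω] at this; exact this
    · have := hLω.2; rw [hF3 ω hω] at this; exact this
  -- (c) σ ∩ CSR ⊆ (Rq ∩ σ) \ V
  have hc : σ ∩ CSR ⊆ (Rq ∩ σ) \ V := by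
    rintro ω ⟨hω, hRω⟩
    change PR (ω ∩ {e | o ∉ e}) at hRω
    obtain ⟨hny, hone, hcard⟩ := hRω
    have hVω : ω ∉ V := hF5 ω hω hny
    refine ⟨⟨⟨?_, ?_⟩, hω⟩, hVω⟩
    · show (A.filter fun x => ω ∈ openConn q x).card ≤ j
      rw [hF4a ω hVω]; exact hcard
    · show 1 ≤ (A.filter fun x => ω ∈ openConn o x).card
      rw [hF3 ω hω]; exact hone
  -- (d) independence
  have hdL : μ.real (σ ∩ CSL) = μ.real σ * μ.real CSL := measureReal_starEvent_inter_avoid w o ↑B PL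
  have hdR : μ.real (σ ∩ CSR) = μ.real σ * μ.real CSR := measureReal_starEvent_inter_avoid w o ↑B PR
  -- assemble
  have hsplitL := measureReal_inter_add_sdiff (μ := μ) (s := L ∩ σ) (MeasurableSet.of_discrete (s := V))
    (measure_ne_top _ _)
  have hsplitR := measureReal_inter_add_sdiff (μ := μ) (s := Rq ∩ σ) (MeasurableSet.of_discrete (s := V))
    (measure_ne_top _ _)
  have h1 : μ.real (L ∩ σ ∩ V) ≤ μ.real (Rq ∩ σ ∩ V) := measureReal_mono ha (measure_ne_top _ _)
  have h2 : μ.real ((L ∩ σ) \ V) ≤ μ.real (σ ∩ CSL) := measureReal_mono hb (measure_ne_top _ _)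
  have h3 : μ.real (σ ∩ CSL) ≤ μ.real (σ ∩ CSR) := by
    rw [hdL, hdR]
    exact mul_le_mul_of_nonneg_left hkey measureReal_nonneg
  have h4 : μ.real (σ ∩ CSR) ≤ μ.real ((Rq ∩ σ) \ V) := measureReal_mono hc (measure_ne_top _ _)
  calc μ.real (L ∩ σ) = μ.real (L ∩ σ ∩ V) + μ.real ((L ∩ σ) \ V) := hsplitL.symm
    _ ≤ μ.real (Rq ∩ σ ∩ V) + μ.real ((Rq ∩ σ) \ V) := by linarith
    _ = μ.real (Rq ∩ σ) := hsplitR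

/-- **Guarded stability from a member no lighter than the witness.**  In any weighted graph (`μ = prodBernoulli u`), for a
finite vertex set `B`, a member `y ∈ B` (relay or not) and a vertex `q ≠ y` with `μ{|π(y)| ≤ j} ≤ μ{|π(q)| ≤ j}`:
`μ(q ≁ B, 1 ≤ |π(B)| ≤ j) ≤ μ(q ≁ B, 1 ≤ |π(B)| ∧ |π(q)| ≤ j)`, where `π(B)` = relays joined to some vertex of `B`.
(`|π(y)| ≤ |π(B)|` pointwise; on `{|π(B)| = 0}` also `|π(y)| = 0 ≤ j`, so that mass is subtracted from both sides of
separation stability `CutObserver.separation_stable` for `(q, y)` away from `B`.)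
[cite: VandenbergHaggstromKahn2005, Thm. 1.5 (p. 7) — corollary] -/
theorem guardedStability_of_member (u : Sym2 (Fin n) → unitInterval) (A B : Finset (Fin n)) {y q : Fin n}
    (hyB : y ∈ B) (hqy : q ≠ y) (j : ℕ)
    (hle : (prodBernoulli u).real {ω : BondConfig (Fin n) | (A.filter fun z => (openGraph ω).Reachable y z).card ≤ j} ≤
      (prodBernoulli u).real {ω : BondConfig (Fin n) | (A.filter fun z => (openGraph ω).Reachable q z).card ≤ j}) :
    (prodBernoulli u).real {ω : BondConfig (Fin n) |
        (∀ m ∈ B, ¬ (openGraph ω).Reachable q m) ∧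
          1 ≤ (A.filter fun z => ∃ x ∈ B, (openGraph ω).Reachable x z).card ∧
          (A.filter fun z => ∃ x ∈ B, (openGraph ω).Reachable x z).card ≤ j} ≤
      (prodBernoulli u).real {ω : BondConfig (Fin n) |
        (∀ m ∈ B, ¬ (openGraph ω).Reachable q m) ∧
          1 ≤ (A.filter fun z => ∃ x ∈ B, (openGraph ω).Reachable x z).card ∧
          (A.filter fun z => (openGraph ω).Reachable q z).card ≤ j} := by
  haveI : IsProbabilityMeasure (prodBernoulli u) := inferInstance
  set μ := prodBernoulli u with hμ
  set MB : BondConfig (Fin n) → ℕ := fun ω =>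
    (A.filter fun z => ∃ x ∈ B, (openGraph ω).Reachable x z).card with hMB
  set Ly : BondConfig (Fin n) → ℕ := fun ω => (A.filter fun z => (openGraph ω).Reachable y z).card with hLy
  set Lq : BondConfig (Fin n) → ℕ := fun ω => (A.filter fun z => (openGraph ω).Reachable q z).card with hLq
  set D := {ω : BondConfig (Fin n) | ∀ m ∈ B, ¬ (openGraph ω).Reachable q m} with hD
  set Z := {ω : BondConfig (Fin n) | (∀ m ∈ B, ¬ (openGraph ω).Reachable q m) ∧ ¬ 1 ≤ MB ω} with hZ
  have hsep := separation_stable u A hqy B j hle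
  change μ.real (D ∩ {ω | Ly ω ≤ j}) ≤ μ.real (D ∩ {ω | Lq ω ≤ j}) at hsep
  change μ.real {ω | (∀ m ∈ B, ¬ (openGraph ω).Reachable q m) ∧ 1 ≤ MB ω ∧ MB ω ≤ j} ≤
    μ.real {ω | (∀ m ∈ B, ¬ (openGraph ω).Reachable q m) ∧ 1 ≤ MB ω ∧ Lq ω ≤ j}
  -- pointwise: |π(y)| ≤ |π(B)|
  have hLyMB : ∀ ω, Ly ω ≤ MB ω := by
    intro ω
    refine Finset.card_le_card fun z hz => ?_
    rw [Finset.mem_filter] at hz ⊢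
    exact ⟨hz.1, y, hyB, hz.2⟩
  have hZsub : Z ⊆ D ∩ {ω | Ly ω ≤ j} := by
    intro ω hω
    refine ⟨hω.1, ?_⟩
    show Ly ω ≤ j
    have h0 : MB ω = 0 := by have h := hω.2; omega
    have := hLyMB ω
    omega
  have h1 : {ω : BondConfig (Fin n) | (∀ m ∈ B, ¬ (openGraph ω).Reachable q m) ∧ 1 ≤ MB ω ∧ MB ω ≤ j} ⊆
      (D ∩ {ω | Ly ω ≤ j}) \ Z := by
    rintro ω ⟨hd, hone, hj⟩
    exact ⟨⟨hd, (hLyMB ω).trans hj⟩, fun hz => hz.2 hone⟩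
  have h2 : (D ∩ {ω | Lq ω ≤ j}) \ Z ⊆
      {ω : BondConfig (Fin n) | (∀ m ∈ B, ¬ (openGraph ω).Reachable q m) ∧ 1 ≤ MB ω ∧ Lq ω ≤ j} := by
    rintro ω ⟨⟨hd, hq⟩, hz⟩
    refine ⟨hd, ?_, hq⟩
    by_contra h
    exact hz ⟨hd, h⟩
  -- remove the mass of Z from both sides of separation stability
  have hsdiff1 := measureReal_inter_add_sdiff (μ := μ) (s := D ∩ {ω | Ly ω ≤ j})
    (MeasurableSet.of_discrete (s := Z)) (measure_ne_top _ _)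
  have hsdiff2 := measureReal_inter_add_sdiff (μ := μ) (s := D ∩ {ω | Lq ω ≤ j})
    (MeasurableSet.of_discrete (s := Z)) (measure_ne_top _ _)
  have hZ1 : μ.real (D ∩ {ω | Ly ω ≤ j} ∩ Z) = μ.real Z := by
    rw [inter_eq_right.2 hZsub]
  have hZ2 : μ.real (D ∩ {ω | Lq ω ≤ j} ∩ Z) ≤ μ.real Z :=
    measureReal_mono inter_subset_right (measure_ne_top _ _)
  calc μ.real {ω | (∀ m ∈ B, ¬ (openGraph ω).Reachable q m) ∧ 1 ≤ MB ω ∧ MB ω ≤ j}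
      ≤ μ.real ((D ∩ {ω | Ly ω ≤ j}) \ Z) := measureReal_mono h1 (measure_ne_top _ _)
    _ = μ.real (D ∩ {ω | Ly ω ≤ j}) - μ.real Z := by linarith
    _ ≤ μ.real (D ∩ {ω | Lq ω ≤ j}) - μ.real Z := by linarith
    _ ≤ μ.real ((D ∩ {ω | Lq ω ≤ j}) \ Z) := by linarith
    _ ≤ μ.real {ω | (∀ m ∈ B, ¬ (openGraph ω).Reachable q m) ∧ 1 ≤ MB ω ∧ Lq ω ≤ j} :=
        measureReal_mono h2 (measure_ne_top _ _)

end CutObserver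

open CutObserver KNPreFKG in
/-- **The T-form (XZ) at a general observer from GUARDED set stability in `G − o`.**  Let `o ∉ A`, `q ≠ o` any vertex,
`x ~' y` an open path avoiding `o`, `π'(y)` the relays so joined to `y`, `s(y) = μ{|π'(y)| ≤ j}`.  Assume `hCS`: for every
nonempty finite set `B` of positive-weight neighbours of `o` that are all LIGHTER than `q` (`y ≠ o`, `w s(o,y) ≠ 0`,
`s(q) < s(y)` for all `y ∈ B`) the guarded stability inequality
`μ(q ≁' B, 1 ≤ |π'(B)| ≤ j) ≤ μ(q ≁' B, 1 ≤ |π'(B)| ∧ |π'(q)| ≤ j)` holds.  Then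
`μ{1 ≤ N ≤ j} ≤ μ({|π(q)| ≤ j} ∩ {1 ≤ N})` — for `q ∈ A` the conclusion of `stub_attachedChampion(Deleted)` at this
observer with the witness `q`.  Stars with a member `y` no lighter than `q` (`s(y) ≤ s(q)`) are free by
`CutObserver.guardedStability_of_member`; the empty star carries no mass of `{1 ≤ N}`.
[cite: VandenbergHaggstromKahn2005, Thm. 1.5 (p. 7); KozmaNitzan2024, Lemma 5 and Thm. 4 (pp. 13–14) — star decomposition] -/
theorem tform_of_guardedStarStability (w : Sym2 (Fin n) → unitInterval) (A : Finset (Fin n)) (o q : Fin n) (j : ℕ)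
    (hoA : o ∉ A) (hqo : q ≠ o)
    (hCS : ∀ B : Finset (Fin n), B.Nonempty →
      (∀ y ∈ B, y ≠ o ∧ w s(o, y) ≠ 0 ∧
        (prodBernoulli w).real {ω : BondConfig (Fin n) |
            (A.filter fun z => (openGraph (ω ∩ {e | o ∉ e})).Reachable q z).card ≤ j} <
          (prodBernoulli w).real {ω : BondConfig (Fin n) |
            (A.filter fun z => (openGraph (ω ∩ {e | o ∉ e})).Reachable y z).card ≤ j}) →
      (prodBernoulli w).real {ω : BondConfig (Fin n) |
          (∀ y ∈ B, ¬ (openGraph (ω ∩ {e | o ∉ e})).Reachable q y) ∧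
            1 ≤ (A.filter fun z => ∃ y ∈ B, (openGraph (ω ∩ {e | o ∉ e})).Reachable y z).card ∧
            (A.filter fun z => ∃ y ∈ B, (openGraph (ω ∩ {e | o ∉ e})).Reachable y z).card ≤ j} ≤
        (prodBernoulli w).real {ω : BondConfig (Fin n) |
          (∀ y ∈ B, ¬ (openGraph (ω ∩ {e | o ∉ e})).Reachable q y) ∧
            1 ≤ (A.filter fun z => ∃ y ∈ B, (openGraph (ω ∩ {e | o ∉ e})).Reachable y z).card ∧
            (A.filter fun z => (openGraph (ω ∩ {e | o ∉ e})).Reachable q z).card ≤ j}) :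
    (prodBernoulli w).real {ω : BondConfig (Fin n) |
        1 ≤ (A.filter fun x => ω ∈ openConn o x).card ∧ (A.filter fun x => ω ∈ openConn o x).card ≤ j} ≤
      (prodBernoulli w).real {ω : BondConfig (Fin n) |
        (A.filter fun x => ω ∈ openConn q x).card ≤ j ∧ 1 ≤ (A.filter fun x => ω ∈ openConn o x).card} := by
  haveI : IsProbabilityMeasure (prodBernoulli w) := inferInstance
  set μ := prodBernoulli w with hμ
  set L := {ω : BondConfig (Fin n) |
    1 ≤ (A.filter fun x => ω ∈ openConn o x).card ∧ (A.filter fun x => ω ∈ openConn o x).card ≤ j} with hL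
  set Rq := {ω : BondConfig (Fin n) | (A.filter fun x => ω ∈ openConn q x).card ≤ j ∧
    1 ≤ (A.filter fun x => ω ∈ openConn o x).card} with hRq
  -- the `K`-lightness of a vertex
  set sW : Fin n → ℝ := fun y => μ.real {ω : BondConfig (Fin n) |
    (A.filter fun z => (openGraph (ω ∩ {e | o ∉ e})).Reachable y z).card ≤ j} with hsW
  -- positive-weight neighbours of `o`
  set Γ : Finset (Fin n) := Finset.univ.filter fun v => v ≠ o ∧ w s(o, v) ≠ 0 with hΓ
  have hΓo : o ∉ Γ := by
    rw [hΓ, Finset.mem_filter]; exact fun h => h.2.1 rfl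
  have hiso : ∀ v, v ≠ o → v ∉ Γ → w s(o, v) = 0 := by
    intro v hvo hvΓ
    by_contra hne
    exact hvΓ (Finset.mem_filter.2 ⟨Finset.mem_univ _, hvo, hne⟩)
  rw [real_eq_sum_inter_starEvent w Γ o hΓo hiso L, real_eq_sum_inter_starEvent w Γ o hΓo hiso Rq]
  refine Finset.sum_le_sum fun B hB => ?_
  have hBΓ : B ⊆ Γ := Finset.mem_powerset.1 hB
  have hBo : ∀ y ∈ B, y ≠ o := fun y hy => (Finset.mem_filter.1 (hBΓ hy)).2.1
  rcases B.eq_empty_or_nonempty with rfl | hBne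
  · -- the empty star: `o` is isolated, `N = 0`
    have h0 : L ∩ starEvent o ↑(∅ : Finset (Fin n)) = (∅ : Set (BondConfig (Fin n))) := by
      ext ω
      simp only [mem_inter_iff, mem_empty_iff_false, iff_false, not_and]
      intro hLω hσ
      rw [Finset.coe_empty] at hσ
      obtain ⟨x, hx⟩ := Finset.card_pos.1 (lt_of_lt_of_le Nat.zero_lt_one hLω.1)
      rw [Finset.mem_filter] at hx
      exact not_reachable_of_mem_starEvent_empty hσ (fun h => hoA (h ▸ hx.1)) hx.2
    rw [h0, measureReal_empty]
    exact measureReal_nonneg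
  · refine star_transfer_guarded w A o q j hoA hqo B hBo ?_
    -- the guarded stability inequality for the star `B`
    by_cases hqB : q ∈ B
    · -- `q` is itself attached to `o`: `q ≁' B` is impossible, the left event is empty
      refine measureReal_mono (fun ω hω => ?_) (measure_ne_top _ _)
      exact absurd (SimpleGraph.Reachable.refl q) (hω.1 q hqB)
    by_cases hheavy : ∃ y ∈ B, sW y ≤ sW q
    · -- a member no lighter than `q`: guarded stability in the graph without the edges at `o`
      obtain ⟨y, hyB, hy⟩ := hheavy
      have hqy : q ≠ y := fun h => hqB (h ▸ hyB)
      set u : Sym2 (Fin n) → unitInterval := fun e => if e ∈ {e : Sym2 (Fin n) | o ∉ e} then w e else 0 with hu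
      have e1 : ∀ x : Fin n, {ω : BondConfig (Fin n) |
            (A.filter fun z => (openGraph (ω ∩ {e | o ∉ e})).Reachable x z).card ≤ j} =
          {ω : BondConfig (Fin n) | ω ∩ {e | o ∉ e} ∈
            {ξ : BondConfig (Fin n) | (A.filter fun z => (openGraph ξ).Reachable x z).card ≤ j}} :=
        fun x => rfl
      have hle : (prodBernoulli u).real
            {ξ : BondConfig (Fin n) | (A.filter fun z => (openGraph ξ).Reachable y z).card ≤ j} ≤
          (prodBernoulli u).real
            {ξ : BondConfig (Fin n) | (A.filter fun z => (openGraph ξ).Reachable q z).card ≤ j} := by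
        have h := hy
        simp only [hsW] at h
        rw [e1 y, e1 q, measureReal_preimage_avoid, measureReal_preimage_avoid] at h
        exact h
      have key := guardedStability_of_member u A B hyB hqy j hle
      have e2 : {ω : BondConfig (Fin n) |
            (∀ y ∈ B, ¬ (openGraph (ω ∩ {e | o ∉ e})).Reachable q y) ∧
              1 ≤ (A.filter fun z => ∃ y ∈ B, (openGraph (ω ∩ {e | o ∉ e})).Reachable y z).card ∧
              (A.filter fun z => ∃ y ∈ B, (openGraph (ω ∩ {e | o ∉ e})).Reachable y z).card ≤ j} =
          {ω : BondConfig (Fin n) | ω ∩ {e | o ∉ e} ∈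
            {ξ : BondConfig (Fin n) | (∀ m ∈ B, ¬ (openGraph ξ).Reachable q m) ∧
              1 ≤ (A.filter fun z => ∃ x ∈ B, (openGraph ξ).Reachable x z).card ∧
              (A.filter fun z => ∃ x ∈ B, (openGraph ξ).Reachable x z).card ≤ j}} := rfl
      have e3 : {ω : BondConfig (Fin n) |
            (∀ y ∈ B, ¬ (openGraph (ω ∩ {e | o ∉ e})).Reachable q y) ∧
              1 ≤ (A.filter fun z => ∃ y ∈ B, (openGraph (ω ∩ {e | o ∉ e})).Reachable y z).card ∧
              (A.filter fun z => (openGraph (ω ∩ {e | o ∉ e})).Reachable q z).card ≤ j} =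
          {ω : BondConfig (Fin n) | ω ∩ {e | o ∉ e} ∈
            {ξ : BondConfig (Fin n) | (∀ m ∈ B, ¬ (openGraph ξ).Reachable q m) ∧
              1 ≤ (A.filter fun z => ∃ x ∈ B, (openGraph ξ).Reachable x z).card ∧
              (A.filter fun z => (openGraph ξ).Reachable q z).card ≤ j}} := rfl
      rw [e2, e3, measureReal_preimage_avoid, measureReal_preimage_avoid]
      exact key
    · -- all members light: hypothesis `hCS`
      push Not at hheavy
      exact hCS B hBne fun y hy => ⟨hBo y hy, (Finset.mem_filter.1 (hBΓ hy)).2.2, hheavy y hy⟩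

open CutObserver in
/-- **T-form (XZ-H shape) when every gate is dominated — relay OR Steiner gates.**  Let `o ∉ A`, `q ≠ o`, and suppose
every positive-weight neighbour `y` of `o` is at most as often light in `G − o` as `q`: `s(y) ≤ s(q)` (for a non-relay
`y`, `s(y) = μ{|π'(y)| ≤ j}` counts the relays joined to `y` off `o`).  Then
`μ{1 ≤ N ≤ j} ≤ μ({|π(q)| ≤ j} ∩ {1 ≤ N})`.  Extends `Theorems.attachedChampion_of_relayPorts_dominated` (all neighbours
relays); with Steiner neighbours the guard `{1 ≤ N}` is genuinely smaller than "some edge at `o` is open".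
[cite: VandenbergHaggstromKahn2005, Thm. 1.5 (p. 7)] -/
theorem attachedChampion_of_gates_dominated (w : Sym2 (Fin n) → unitInterval) (A : Finset (Fin n)) (o q : Fin n)
    (j : ℕ) (hoA : o ∉ A) (hqo : q ≠ o)
    (hdom : ∀ y : Fin n, y ≠ o → w s(o, y) ≠ 0 →
      (prodBernoulli w).real {ω : BondConfig (Fin n) |
          (A.filter fun z => (openGraph (ω ∩ {e | o ∉ e})).Reachable y z).card ≤ j} ≤
        (prodBernoulli w).real {ω : BondConfig (Fin n) |
          (A.filter fun z => (openGraph (ω ∩ {e | o ∉ e})).Reachable q z).card ≤ j}) :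
    (prodBernoulli w).real {ω : BondConfig (Fin n) |
        1 ≤ (A.filter fun x => ω ∈ openConn o x).card ∧ (A.filter fun x => ω ∈ openConn o x).card ≤ j} ≤
      (prodBernoulli w).real {ω : BondConfig (Fin n) |
        (A.filter fun x => ω ∈ openConn q x).card ≤ j ∧ 1 ≤ (A.filter fun x => ω ∈ openConn o x).card} := by
  refine tform_of_guardedStarStability w A o q j hoA hqo fun B hB hlight => ?_
  obtain ⟨y, hy⟩ := hB
  obtain ⟨hyo, hwy, hlt⟩ := hlight y hy
  exact absurd (hdom y hyo hwy) (not_le.2 hlt)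

end Summit.CriticalPhenomena.PercolationContinuityZ3.Theorems

end
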